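import Summits.MatrixMultiplication.MatrixMultiplication.Theorems.FarEdgeDescentTowerBoxRate
import Summits.MatrixMultiplication.MatrixMultiplication.Theorems.FarEdgeDescentTowerFixedPoint
import HarnessLib

/-!
# Far-edge descent, kernel XXX-C4: the limit order of the clock-7 crude tower

Route `FarEdgeDescent`, special leaf `FiniteSaturation` (stmt-MatrixMultiplication-23739): helper
kernel, THESES-FREE and def-free.  Kernels XXX-C1/C2 give `RateBeyond θ` for every
`θ < log₇lo/(1 − log₇lo)` from ANY certified box `(J, α, β, lo)` of the clock-`7` full-class crude
tower; kernel XXX-C3 supplies the boxes `[m*−ε, m*+ε]` around the fixed point `m*` of the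
legs-ratio map `f` (`m* ∈ [0.17461, 0.174611]`), entered at a finite stage.  A continuity argument
in `ε` now yields every multiplier `lo < λ(m*) = 7(1−m*)⁶/(1+φ(m*))`, hence the LIMIT ORDER of the
method (`rateBeyond_towerLimit`):

  `RateBeyond θ` for every `θ < κ*/(1−κ*)`, `κ* = log₇ λ(m*) = 0.30968…`, `κ*/(1−κ*) = 0.44860…`,

with the certified floor `13/29 = 0.4482…` (`rateBeyond_of_le_thirteen_twentyNinths`; kernel
XXX-C3's `1.8268^42 > 7^13`).  Rate frontier of the route so far: `1/3` (g22) → `0.369`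
(g47–48) → `0.4066` (g50, pairs) → `0.4269` (XXX-B3) → `0.4446` (XXX-C2) → `0.4486⁻` (here).  Beyond
this, within tensor-free real analysis of the SAME tower, nothing is left: `0.44861` is the exact
exponent of the clock-`7` crude deviation dynamics (clock `7` is optimal among clocks `2…20`,
instrumented); the improvable (Pan §16 / Stothers) towers reach `0.70951` but need a Literature
DEFINITION of improvable approximate realisations first.

References: Pan 1984 (LNCS 179) §17, Thm. 17.1; Lotti–Romani 1983, Thm. 3.1, Prop. 4.1;
Alman–Duan–Vassilevska Williams–Xu–Xu–Zhou 2025, §1.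
Tags: `FiniteSaturation` (h₁) NEC · WEAKER (`RateBeyond θ` for all `θ < 0.44860…` are theorems) ·
a rate bound never implies (h₁).
-/

set_option linter.dupNamespace false

noncomputable section

open scoped BigOperators Topology

namespace Summit.MatrixMultiplication.MatrixMultiplication.Theorems.FarEdgeDescentTowerLimit

open Literature.Computability.AlgebraicComplexity
open Summit.MatrixMultiplication.MatrixMultiplication.Theorems.FarEdgeDescentTowerRatio
open Summit.MatrixMultiplication.MatrixMultiplication.Theorems.FarEdgeDescentTowerBox
open Summit.MatrixMultiplication.MatrixMultiplication.Theorems.FarEdgeDescentTowerBoxRate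
open Summit.MatrixMultiplication.MatrixMultiplication.Theorems.FarEdgeDescentTowerFixedPoint

variable (K : Type) [Field K]

/-- **Every multiplier below `λ(m*)` is certified.**  If `m*` is the fixed point of `f` and
`1 < lo < λ(m*)`, then `RateBeyond θ` for every `θ < log₇lo/(1 − log₇lo)`: a small box
`[m*−ε, m*+ε]` (kernel XXX-C3) has multiplier `≥ lo` by continuity in `ε`, and kernel XXX-C2
applies. [cite: Pan1984, Thm. 17.1; LottiRomani1983, Thm. 3.1, Prop. 4.1] -/
theorem rateBeyond_of_lt_lambda_fixedPoint {mstar : ℝ} (hm1 : (17461 : ℝ) / 100000 ≤ mstar)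
    (hm2 : mstar ≤ 174611 / 1000000)
    (hfix : ((1 - mstar) ^ 7 - (1 - 2 * mstar) ^ 7) / (1 + ((1 - mstar) ^ 7 - (1 - 2 * mstar) ^ 7))
      = mstar)
    {lo : ℝ} (hlo1 : 1 < lo)
    (hlt : lo < 7 * (1 - mstar) ^ 6 / (1 + ((1 - mstar) ^ 7 - (1 - 2 * mstar) ^ 7)))
    {θ : ℝ} (hθ : θ < Real.logb 7 lo / (1 - Real.logb 7 lo)) :
    ∃ δ C : ℝ, θ < δ ∧ ∀ k : ℕ, 1 ≤ k →
      omegaRect K 1 k 1 - (k + 1) ≤ C * (k : ℝ) ^ (-δ) := by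
  obtain ⟨-, hlam2⟩ := lambda_fixedPoint_bounds hm1 hm2
  have hlo2 : lo ≤ 2 := by linarith
  have hφpos : 0 < 1 + ((1 - mstar) ^ 7 - (1 - 2 * mstar) ^ 7) := by
    linarith [phi_nonneg (m := mstar) (by linarith) (by linarith)]
  -- h(ε) = 7(1−(m*+ε))⁶ − lo(1+φ(m*−ε)) is continuous with h(0) > 0
  have hcont : Continuous fun ε : ℝ => 7 * (1 - (mstar + ε)) ^ 6 -
      lo * (1 + ((1 - (mstar - ε)) ^ 7 - (1 - 2 * (mstar - ε)) ^ 7)) := by fun_prop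
  have h0 : 0 < 7 * (1 - (mstar + 0)) ^ 6 -
      lo * (1 + ((1 - (mstar - 0)) ^ 7 - (1 - 2 * (mstar - 0)) ^ 7)) := by
    simp only [add_zero, sub_zero]
    rw [lt_div_iff₀ hφpos] at hlt
    linarith
  have hev : ∀ᶠ ε in 𝓝 (0 : ℝ), 0 < 7 * (1 - (mstar + ε)) ^ 6 -
      lo * (1 + ((1 - (mstar - ε)) ^ 7 - (1 - 2 * (mstar - ε)) ^ 7)) :=
    (hcont.tendsto 0).eventually_const_lt h0
  obtain ⟨d, hd0, hd⟩ := Metric.eventually_nhds_iff.mp hev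
  set ε : ℝ := min (d / 2) (1 / 1000) with hε
  have hε0 : 0 < ε := by rw [hε]; exact lt_min (by linarith) (by norm_num)
  have hε1 : ε ≤ 1 / 1000 := min_le_right _ _
  have hεd : dist ε 0 < d := by
    rw [Real.dist_eq, sub_zero, abs_of_pos hε0]
    exact lt_of_le_of_lt (min_le_left _ _) (by linarith)
  have hpos := hd hεd
  obtain ⟨hα, hβ, hc1, hc2, J, hbox⟩ := certBox_around_fixedPoint hm1 hm2 hfix hε0 hε1
  exact rateBeyond_of_cert K (α := mstar - ε) (β := mstar + ε) hα hβ hlo1 hlo2 (by linarith)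
    (J := J) hbox hθ

/-- **The limit order of the clock-7 crude tower.**  There is `m* ∈ [0.17461, 0.174611]` with
`f(m*) = m*` such that `RateBeyond θ` holds (every field) for every
`θ < κ*/(1−κ*)`, `κ* = log₇(7(1−m*)⁶/(1+φ(m*)))`; numerically `κ*/(1−κ*) = 0.44860…`.
[cite: Pan1984, Thm. 17.1; LottiRomani1983, Thm. 3.1, Prop. 4.1;
AlmanDuanVassilevskaWilliamsXuXuZhou2025, §1] -/
theorem rateBeyond_towerLimit :
    ∃ mstar : ℝ, (17461 : ℝ) / 100000 ≤ mstar ∧ mstar ≤ 174611 / 1000000 ∧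
      ((1 - mstar) ^ 7 - (1 - 2 * mstar) ^ 7) / (1 + ((1 - mstar) ^ 7 - (1 - 2 * mstar) ^ 7))
        = mstar ∧
      ∀ θ : ℝ, θ < Real.logb 7 (7 * (1 - mstar) ^ 6 / (1 + ((1 - mstar) ^ 7 - (1 - 2 * mstar) ^ 7))) /
          (1 - Real.logb 7 (7 * (1 - mstar) ^ 6 / (1 + ((1 - mstar) ^ 7 - (1 - 2 * mstar) ^ 7)))) →
        ∃ δ C : ℝ, θ < δ ∧ ∀ k : ℕ, 1 ≤ k →
          omegaRect K 1 k 1 - (k + 1) ≤ C * (k : ℝ) ^ (-δ) := by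
  obtain ⟨mstar, hm1, hm2, hfix⟩ := exists_fixedPoint
  refine ⟨mstar, hm1, hm2, hfix, ?_⟩
  obtain ⟨hlam1, hlam2⟩ := lambda_fixedPoint_bounds hm1 hm2
  -- abbreviations by `have`: λ* > 1, κ* ∈ (0,1)
  have hlampos : (0 : ℝ) < 7 * (1 - mstar) ^ 6 / (1 + ((1 - mstar) ^ 7 - (1 - 2 * mstar) ^ 7)) := by
    linarith
  have hκ0 : 0 < Real.logb 7 (7 * (1 - mstar) ^ 6 / (1 + ((1 - mstar) ^ 7 - (1 - 2 * mstar) ^ 7))) :=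
    Real.logb_pos (by norm_num) (by linarith)
  have hκ1 : Real.logb 7 (7 * (1 - mstar) ^ 6 / (1 + ((1 - mstar) ^ 7 - (1 - 2 * mstar) ^ 7))) < 1 := by
    have h := Real.logb_lt_logb (b := 7) (by norm_num) hlampos (by linarith :
      7 * (1 - mstar) ^ 6 / (1 + ((1 - mstar) ^ 7 - (1 - 2 * mstar) ^ 7)) < 7)
    rwa [Real.logb_self_eq_one (by norm_num)] at h
  -- reduce to θ ≥ 0
  suffices hmain : ∀ θ : ℝ, 0 ≤ θ →
      θ < Real.logb 7 (7 * (1 - mstar) ^ 6 / (1 + ((1 - mstar) ^ 7 - (1 - 2 * mstar) ^ 7))) /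
          (1 - Real.logb 7 (7 * (1 - mstar) ^ 6 / (1 + ((1 - mstar) ^ 7 - (1 - 2 * mstar) ^ 7)))) →
        ∃ δ C : ℝ, θ < δ ∧ ∀ k : ℕ, 1 ≤ k →
          omegaRect K 1 k 1 - (k + 1) ≤ C * (k : ℝ) ^ (-δ) by
    intro θ hθ
    rcases le_or_gt 0 θ with hθ0 | hθ0
    · exact hmain θ hθ0 hθ
    · obtain ⟨δ, C, hδ, hC⟩ := hmain 0 le_rfl (by
        rw [lt_div_iff₀ (by linarith)]; linarith)
      exact ⟨δ, C, by linarith, hC⟩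
  intro θ hθ0 hθ
  -- κ' strictly between t₀ = θ/(1+θ) and κ*;  lo = 7^κ'
  set κs := Real.logb 7 (7 * (1 - mstar) ^ 6 / (1 + ((1 - mstar) ^ 7 - (1 - 2 * mstar) ^ 7)))
    with hκs
  have ht0 : θ / (1 + θ) < κs := by
    rw [div_lt_iff₀ (by linarith)]
    rw [lt_div_iff₀ (by linarith)] at hθ
    linarith
  have ht0' : 0 ≤ θ / (1 + θ) := div_nonneg hθ0 (by linarith)
  set κ' := (θ / (1 + θ) + κs) / 2 with hκ'
  have hκ'1 : θ / (1 + θ) < κ' := by rw [hκ']; linarith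
  have hκ'2 : κ' < κs := by rw [hκ']; linarith
  have hκ'0 : 0 < κ' := by linarith
  have hlo1 : (1 : ℝ) < (7 : ℝ) ^ κ' := Real.one_lt_rpow (by norm_num) hκ'0
  have hlolt : (7 : ℝ) ^ κ' < 7 * (1 - mstar) ^ 6 / (1 + ((1 - mstar) ^ 7 - (1 - 2 * mstar) ^ 7)) := by
    have h := Real.rpow_lt_rpow_of_exponent_lt (by norm_num : (1 : ℝ) < 7) hκ'2
    rwa [hκs, Real.rpow_logb (by norm_num) (by norm_num) hlampos] at h
  have hlog : Real.logb 7 ((7 : ℝ) ^ κ') = κ' := Real.logb_rpow (by norm_num) (by norm_num)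
  have hθ' : θ < Real.logb 7 ((7 : ℝ) ^ κ') / (1 - Real.logb 7 ((7 : ℝ) ^ κ')) := by
    rw [hlog, lt_div_iff₀ (by linarith)]
    rw [div_lt_iff₀ (by linarith)] at hκ'1
    nlinarith
  exact rateBeyond_of_lt_lambda_fixedPoint K hm1 hm2 hfix hlo1 hlolt hθ'

/-- **`RateBeyond θ` for every `θ ≤ 13/29 = 0.4482…`** (every field) — the certified floor of the
limit order `0.44860…`. [cite: LottiRomani1983, Prop. 4.1; Pan1984, Thm. 17.1] -/
theorem rateBeyond_of_le_thirteen_twentyNinths {θ : ℝ} (hθ : θ ≤ 13 / 29) :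
    ∃ δ C : ℝ, θ < δ ∧ ∀ k : ℕ, 1 ≤ k →
      omegaRect K 1 k 1 - (k + 1) ≤ C * (k : ℝ) ^ (-δ) := by
  obtain ⟨mstar, hm1, hm2, hfix, h⟩ := rateBeyond_towerLimit K
  exact h θ (lt_of_le_of_lt hθ (limitOrder_gt hm1 hm2))

end Summit.MatrixMultiplication.MatrixMultiplication.Theorems.FarEdgeDescentTowerLimit

end
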